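import Summits.BirchSwinnertonDyer.BirchSwinnertonDyer.Theorems.KatoDescentPotSupersingularExactFineControl
import Summits.BirchSwinnertonDyer.BirchSwinnertonDyer.Theorems.KatoDescentPotSupersingularMemberHullZetaInputsOfCorePrelim
import Literature.NumberTheory.EllipticCurves.IwasawaSelmerControlKernelCardProofs
import Literature.NumberTheory.EllipticCurves.IwasawaCoinvariantsRankProofs
import HarnessLib

/-!
# THE J-ROAD BEYOND THE TAME ROWS, I: INEXACT FINE CONTROL `#Sel_str(ℚ, W[p^∞]) ≤ #W(ℚ̄)[p^∞]^{Γ_ℚ} · #Sel₀(ℚ_∞, W[p^∞])^Γ`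
# (no hypothesis at `p` beyond `W(ℚ_∞)[p^∞]` finite) and the Galois-descent count `#W(ℚ̄)[p^∞]^{Γ_ℚ} ∣ #W(ℚ)_tors` — the two
# inputs by which the sequel `…ReducibleShaBoundWild` extends crux M's inequality-modulo-(b′) to the wild rows (crux M 19196)

Seat `bsd-potss-rkm` g28 (prover, cell `bsd-potss`), item stmt-BirchSwinnertonDyer-19196 `ReducibleKatoMember` = crux M of K9
`KatoDescentPotSupersingular` (support; the WILD prime `3`) / K8-t′ `KatoDescentTamePotSupersingular` (auto-crux); `--supports … --as
helper`; route-free; closes nothing.  HONEST FRAMING: BSD is not proved by any of this; nothing is booked; crux M stays cite-level on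
{modularity, HELD 27962}; theorems only (no definition, no named fact, no `sorry`).

## What and why

The prequels (`…ReducibleH2DescentCount{,Strict}`, `…ReducibleTameShaBound`) prove Kato's Thm. 14.5 (3) at level `0` and crux M's
inequality modulo (b′) on the rows with `W(ℚ_p)[p] = 0`, where g27's EXACT fine control `Sel_str(ℚ, W[p^∞]) ≅ Sel₀(ℚ_∞, W[p^∞])^Γ`
holds.  On K9's wild rows (`p = 3`, `W[3]` reducible, often `W(ℚ_3)[3] ≠ 0`) exact control fails, but the INEQUALITY survives: the
restriction `H¹(ℚ, W[p^∞]) → H¹(ℚ_∞, W[p^∞])` sends Kato's strict Selmer group INTO the `Γ`-invariants of the fine Selmer group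
(§1: Kato's strict condition at `p` trivially implies the fine one; at `ℓ ≠ p` unramified ⟹ trivial over the tower is g27's pro-`p′`
lemma; conjugates of a level-`0` class coincide), with kernel inside `ker(H¹(ℚ, W[p^∞]) → H¹(ℚ_∞, W[p^∞])) = H¹(Γ, W(ℚ_∞)[p^∞])`, of
order `#W(ℚ̄)[p^∞]^{Γ_ℚ} = #W(ℚ)[p^∞]` when `W(ℚ_∞)[p^∞]` is finite (Greenberg L.3.1/L.4.3, tree
`WeierstrassCurve.natCard_ker_layerToInfty_eq_natCard_fixedPoints`).  Hence

* §1 (any number field) `natCard_fixedBy_layerSubgroup_zero_dvd_natCard_torsion` — `#{m ∈ E(K̄)[p^∞] | Γ_K m = m} ∣ #E(K)_tors`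
  (Galois descent), `…_eq_prime_pow`; `finite_fixedPoints_kerSubgroup_of_inf` — `E(K_{v,∞})[p^∞]` finite ⟹ `E(K_∞)[p^∞]` finite;
* §2 `layerToInfty_mem_fineSelmerInfty_of_strict`, `resH1Hom_kerSubgroup_mem_fineSelmerInfty_of_mem_katoStrictSelmer` (no `h4`),
  **`natCard_katoStrictSelmer_le_mul`**: `#Sel_str(ℚ, W[p^∞]) ≤ #{m ∈ W(ℚ̄)[p^∞] | Γ_ℚ m = m} · #Sel₀(ℚ_∞, W[p^∞])^Γ`
  (`p` odd, `κ` cyclotomic, `W(ℚ_∞)[p^∞]` finite, `Sel₀(ℚ_∞)^Γ` finite);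
* SEQUEL `…ReducibleShaBoundWild`: the bound `ord_p #Ш(W)[p^∞] + v_p(Tam W) ≤ e + v_p(c_p) + 3·v_p #W(ℚ)_tors` for Kato's zeta
  lift modulo (b′), on EVERY reducible non-CM rank-0 row with `W(ℚ_{p,∞})[p^∞]` finite (wild `p = 3` included).

READING (K9).  This is M's printed SHAPE (`… ≤ ord_p(L/Ω) + 3·ord_p #tors` once (b′) gives `e`), but on the wild rows Kato's
`e = ord_p(L(W,1)/Ω) + v_p(λ(0)) + t_p − v_p(c_p)` carries `t_p = ord_p #W(ℚ_p)[p^∞] > 0`, which Kato cancels against the local term of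
(14.9.3)/(c2′) (`#𝐇²_Γ/T = #Sel_str · p^{t_p − t₀}`) — a TWO-sided statement about `𝐇² ⊋ X₀` that the one-sided J-road cannot see
(H2X forgets the cokernel).  So on K9's rows the J-road gives M up to `p^{t_p}`; K9's M stays over 27962 (planner TARGET R294), and this
file records exactly how far the atomic facts reach there.

References: K. Kato, Astérisque 295 (2004), Thm. 14.5 (p. 236), (14.9.3) (p. 240), §14.14 (pp. 243–244), Prop. 14.16 (2) (pp. 244–245),
Lemma 14.18 (pp. 247–248) [Kato2004Asterisque]; R. Greenberg, LNM 1716 (1999), §3 Lemma 3.1 (p. 86), §4 Lemma 4.3 (p. 103)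
[GreenbergLNM1716]; H. Imai, Proc. Japan Acad. 51 (1975) 12–16 [Imai1975] (scope remark only); J. S. Milne, *ADT* I Thm. 4.10 (b) [MilneADT2006].
-/

-- the summit and its single problem are both named `BirchSwinnertonDyer` (registry layout D-0017)
set_option linter.dupNamespace false
set_option autoImplicit false

noncomputable section

open scoped Classical NumberField
open Function Field NumberField IsDedekindDomain WeierstrassCurve
open Literature.NumberTheory.EllipticCurves Literature.NumberTheory.EllipticCurves.GreenbergSelmer
  Literature.NumberTheory.EllipticCurves.ZpExtension Literature.NumberTheory.EllipticCurves.Kato2004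
  Literature.NumberTheory.GaloisRepresentations
open Literature.NumberTheory.EllipticCurves.IwasawaDual
open Summit.BirchSwinnertonDyer.BirchSwinnertonDyer.Theorems
  Summit.BirchSwinnertonDyer.BirchSwinnertonDyer.Theorems.ExactFineControlLocal
  Summit.BirchSwinnertonDyer.BirchSwinnertonDyer.Theorems.ExactFineControl

namespace Summit.BirchSwinnertonDyer.BirchSwinnertonDyer.Theorems.ReducibleShaBoundWild

/-! ## §1 Galois descent `#E(K̄)[p^∞]^{Γ_K} ∣ #E(K)_tors`, and local ⟹ global finiteness over the tower (any number field) -/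

section Descent

variable {K : Type} [Field K] [NumberField K] (W : WeierstrassCurve K) [W.IsElliptic] {p : ℕ} [hp : Fact p.Prime]
  (κ : ZpExtension K p)

omit [W.IsElliptic] in
/-- **`#{m ∈ E(K̄)[p^∞] | Γ_{K_0} m = m} ∣ #E(K)_tors`** (`K` a number field, `κ` any `ℤ_p`-extension, `K_0 = K`): a `Γ_K`-fixed point of
`E(K̄)[p^∞]` is `K`-rational (Galois descent, `exists_toGeomPoints_eq_of_forall_smul_eq`) and torsion; the resulting map to `E(K)_tors` is an
injective homomorphism (as in `finite_fixedPoints_geomPrimaryTorsion`).  In particular the group is `E(K)[p^∞]`.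
[cite: SilvermanAEC2009, VIII.§1 (Galois descent)] [cite: GreenbergLNM1716, §4 Lemma 4.3 (`E(F)_p`)] -/
theorem natCard_fixedBy_layerSubgroup_zero_dvd_natCard_torsion :
    Nat.card {m : W.geomPrimaryTorsion p | ∀ σ ∈ κ.layerSubgroup 0, σ • m = m} ∣
      Nat.card (AddCommGroup.torsion W.toAffine.Point) := by
  -- the subgroup of `Γ_K`-fixed points
  let F : AddSubgroup (W.geomPrimaryTorsion p) :=
    { carrier := {m | ∀ σ ∈ κ.layerSubgroup 0, σ • m = m}
      zero_mem' := fun σ _ ↦ smul_zero σ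
      add_mem' := fun {a b} ha hb σ hσ ↦ by rw [smul_add, ha σ hσ, hb σ hσ]
      neg_mem' := fun {a} ha σ hσ ↦ by rw [smul_neg, ha σ hσ] }
  have key : ∀ m : F, ∃ P : AddCommGroup.torsion W.toAffine.Point,
      toGeomPoints W (P : W.toAffine.Point) = ((m : W.geomPrimaryTorsion p) : geomPoints W) := by
    intro m
    have hfix : ∀ σ : Field.absoluteGaloisGroup K,
        σ • ((m : W.geomPrimaryTorsion p) : geomPoints W) = ((m : W.geomPrimaryTorsion p) : geomPoints W) := by
      intro σ
      have hσ : σ ∈ κ.layerSubgroup 0 := by rw [κ.layerSubgroup_zero]; exact Subgroup.mem_top σ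
      rw [← primaryComponent.coe_smul, m.2 σ hσ]
    obtain ⟨P, hP⟩ := exists_toGeomPoints_eq_of_forall_smul_eq W hfix
    obtain ⟨k, hk⟩ := (m : W.geomPrimaryTorsion p).2
    refine ⟨⟨P, ?_⟩, hP⟩
    rw [AddCommGroup.mem_torsion, isOfFinAddOrder_iff_nsmul_eq_zero]
    refine ⟨p ^ k, pow_pos hp.out.pos k, toGeomPoints_injective W ?_⟩
    rw [map_nsmul, hP, map_zero, hk]
  choose P hP using key
  let φ : F →+ AddCommGroup.torsion W.toAffine.Point :=
    { toFun := P
      map_zero' := by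
        apply Subtype.ext; apply toGeomPoints_injective W
        rw [hP]; simp
      map_add' := fun a b ↦ by
        apply Subtype.ext; apply toGeomPoints_injective W
        rw [hP]; simp [hP] }
  have hφ : Function.Injective φ := by
    intro a b hab
    apply Subtype.ext; apply Subtype.ext
    rw [← hP a, ← hP b]
    exact congrArg (fun z ↦ toGeomPoints W ((z : AddCommGroup.torsion W.toAffine.Point) : W.toAffine.Point)) hab
  change Nat.card F ∣ _
  exact AddSubgroup.card_dvd_of_injective φ hφ

/-- **`#{m ∈ E(K̄)[p^∞] | Γ_{K_0} m = m}` is a power of `p`** (a finite subgroup of the `p`-primary `E(K̄)[p^∞]`; finite by the previous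
divisibility into the finite `E(K)_tors`). [cite: SilvermanAEC2009, VIII.§1] -/
theorem natCard_fixedBy_layerSubgroup_zero_eq_prime_pow :
    ∃ n : ℕ, Nat.card {m : W.geomPrimaryTorsion p | ∀ σ ∈ κ.layerSubgroup 0, σ • m = m} = p ^ n := by
  haveI : Finite (AddCommGroup.torsion W.toAffine.Point) := finite_torsion_holds W
  let F : AddSubgroup (W.geomPrimaryTorsion p) :=
    { carrier := {m | ∀ σ ∈ κ.layerSubgroup 0, σ • m = m}
      zero_mem' := fun σ _ ↦ smul_zero σ
      add_mem' := fun {a b} ha hb σ hσ ↦ by rw [smul_add, ha σ hσ, hb σ hσ]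
      neg_mem' := fun {a} ha σ hσ ↦ by rw [smul_neg, ha σ hσ] }
  have hdvd : Nat.card F ∣ Nat.card (AddCommGroup.torsion W.toAffine.Point) :=
    natCard_fixedBy_layerSubgroup_zero_dvd_natCard_torsion W κ (p := p)
  have hF0 : Nat.card F ≠ 0 := fun h0 ↦
    (Nat.card_pos (α := AddCommGroup.torsion W.toAffine.Point)).ne' (Nat.eq_zero_of_zero_dvd (h0 ▸ hdvd))
  haveI : Finite F := Nat.finite_of_card_ne_zero hF0
  change ∃ n : ℕ, Nat.card F = p ^ n
  exact MemberHullZetaInputsOfCore.natCard_eq_prime_pow_of_forall_pow_smul_eq_zero p fun m ↦ by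
    obtain ⟨k, hk⟩ := exists_pow_smul_geomPrimaryTorsion_eq_zero W p (m : W.geomPrimaryTorsion p)
    exact ⟨k, Subtype.ext (by rw [AddSubmonoidClass.coe_nsmul, hk]; rfl)⟩

omit [NumberField K] [W.IsElliptic] in
/-- `E(K_{v,∞})[p^∞]` finite (fixed points of `ker κ ⊓ D`) ⟹ `E(K_∞)[p^∞]` finite (fixed points of `ker κ`): more group, fewer fixed points.
[cite: GreenbergLNM1716, §3 Lemma 3.1 (p. 86)] -/
theorem finite_fixedPoints_kerSubgroup_of_inf (D : Subgroup (Field.absoluteGaloisGroup K))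
    (hfin : Finite (FixedPoints.addSubgroup ↥(κ.kerSubgroup ⊓ D) (W.geomPrimaryTorsion p))) :
    Finite (FixedPoints.addSubgroup κ.kerSubgroup (W.geomPrimaryTorsion p)) := by
  refine Finite.of_injective (fun m ↦ (⟨(m : W.geomPrimaryTorsion p), ?_⟩ :
    FixedPoints.addSubgroup ↥(κ.kerSubgroup ⊓ D) (W.geomPrimaryTorsion p))) fun a b hab ↦ ?_
  · have hm := m.2
    rw [FixedPoints.mem_addSubgroup] at hm ⊢
    rintro ⟨τ, hτ⟩
    rw [Subgroup.mk_smul]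
    have := hm ⟨τ, hτ.1⟩
    rwa [Subgroup.mk_smul] at this
  · apply Subtype.ext
    simpa using congrArg (fun z : FixedPoints.addSubgroup ↥(κ.kerSubgroup ⊓ D) (W.geomPrimaryTorsion p) ↦
      (z : W.geomPrimaryTorsion p)) hab

end Descent

/-! ## §2 Inexact fine control: `Sel_str(ℚ, W[p^∞]) → Sel₀(ℚ_∞, W[p^∞])^Γ` with kernel of order `≤ #W(ℚ̄)[p^∞]^{Γ_ℚ}` -/

section Control

variable (W : WeierstrassCurve ℚ) [W.IsElliptic] {p : ℕ} [hp : Fact p.Prime] (κ : ZpExtension ℚ p)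

omit [W.IsElliptic] in
/-- **Kato's strict conditions imply the fine conditions over the tower, with NO hypothesis at `p`.**  For `p` odd and `κ`
cyclotomic: if a class `y` of `H¹(ℚ, W[p^∞]) = H¹(ℚ_0, W[p^∞])` is trivial on `D_p` and unramified at every `v ≠ v_p`, then its
restriction to `ℚ_∞` lies in `Sel₀(ℚ_∞, W[p^∞])` (trivial on `Gal(ℚ̄/ℚ_∞) ⊓ D_v` for every `v`: at `p` by restriction, at `ℓ ≠ p` by
`UnramifiedTrivialOverTower`, at `∞` vacuously for `p` odd).  The `⟸` half of g27's `layerToInfty_mem_fineSelmerInfty_iff` without `h4`.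
[cite: Kato2004Asterisque, §14.1 (p. 235) and (14.9.3) (p. 240)] [cite: GreenbergLNM1716, Prop. 3.8 (pp. 95–96)] -/
theorem layerToInfty_mem_fineSelmerInfty_of_strict (hp2 : p ≠ 2) (hκ : κ.IsCyclotomic)
    (y : W.subgroupH1 p (κ.layerSubgroup 0))
    (hp0 : W.resOfLe p (le_layerSubgroup_zero κ (decomp (primePlace p))) y = 0)
    (hoff : ∀ v : HeightOneSpectrum (𝓞 ℚ), v ≠ primePlace p →
      W.resOfLe p (le_layerSubgroup_zero κ (GreenbergSelmer.inertia v)) y = 0) :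
    W.layerToInfty κ 0 y ∈ W.fineSelmerInfty κ := by
  have hres : ∀ v : HeightOneSpectrum (𝓞 ℚ),
      resOfLe (W.geomPrimaryTorsion p) (inf_le_left : κ.kerSubgroup ⊓ decomp v ≤ κ.kerSubgroup)
          (W.layerToInfty κ 0 y) =
        W.resOfLe p (le_layerSubgroup_zero κ (κ.kerSubgroup ⊓ decomp v)) y := fun v ↦ by
    have e := congrArg (fun f ↦ f y) (W.resOfLe_comp_holds p
      (inf_le_left : κ.kerSubgroup ⊓ decomp v ≤ κ.kerSubgroup) (κ.kerSubgroup_le_layerSubgroup 0))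
    simp only [AddMonoidHom.coe_comp, Function.comp_apply] at e
    exact e
  rw [WeierstrassCurve.fineSelmerInfty, FineSelmerCoefficientMap.mem_fineSelmerInfty_iff_resOfLe]
  simp only [conjH1_layerToInfty_zero]
  refine ⟨fun v _ ↦ ?_, fun w _ ↦ subgroupH1_inf_decompInf_eq_zero W hp2 κ.kerSubgroup w _⟩
  rw [hres]
  by_cases hv : v = primePlace p
  · subst hv
    -- at `p`: trivial on `D_p` ⟹ trivial on `ker κ ⊓ D_p` (restriction; no hypothesis on `W(ℚ_p)`)
    have e := congrArg (fun f ↦ f y) (W.resOfLe_comp_holds p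
      (inf_le_right : κ.kerSubgroup ⊓ decomp (primePlace p) ≤ decomp (primePlace p))
      (le_layerSubgroup_zero κ (decomp (primePlace p))))
    simp only [AddMonoidHom.coe_comp, Function.comp_apply] at e
    rw [← e, hp0, map_zero]
  · have hv' : ((p : ℕ) : 𝓞 ℚ) ∉ v.asIdeal := fun hm ↦ hv ((natCast_mem_asIdeal_iff_eq_primePlace p v).1 hm)
    exact (resOfLe_kerSubgroup_inf_decomp_eq_zero_iff_resOfLe_inertia_eq_zero W κ hκ hv' y).2 (hoff v hv)

omit [W.IsElliptic] in
/-- **`Sel_str(ℚ, W[p^∞])` restricts INTO `Sel₀(ℚ_∞, W[p^∞])`** (`p` odd, `κ` cyclotomic; no hypothesis at `p`).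
[cite: Kato2004Asterisque, (14.9.3) (p. 240)] [cite: GreenbergLNM1716, Prop. 3.8 (pp. 95–96)] -/
theorem resH1Hom_kerSubgroup_mem_fineSelmerInfty_of_mem_katoStrictSelmer (hp2 : p ≠ 2) (hκ : κ.IsCyclotomic)
    {y : W.galH1Primary p} (hy : y ∈ katoStrictSelmer W p {primePlace p}) :
    resH1Hom (Literature.NumberTheory.EllipticCurves.subgroupIncl κ.kerSubgroup)
        (AddMonoidHom.id (W.geomPrimaryTorsion p)) (fun _ _ ↦ rfl) y ∈ W.fineSelmerInfty κ := by
  rw [resH1Hom_kerSubgroup_eq_layerToInfty]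
  obtain ⟨hp0, hoff⟩ := (mem_katoStrictSelmer_iff W κ y).1 hy
  exact layerToInfty_mem_fineSelmerInfty_of_strict W κ hp2 hκ _ hp0 hoff

omit [W.IsElliptic] in
/-- **INEXACT FINE CONTROL at level `0`: `#Sel_str(ℚ, W[p^∞]) ≤ #W(ℚ̄)[p^∞]^{Γ_ℚ} · #Sel₀(ℚ_∞, W[p^∞])^Γ`** (`p` odd, `κ`
cyclotomic with generator `γ`, `W(ℚ_∞)[p^∞] = W(ℚ̄)[p^∞]^{ker κ}` finite, `Sel₀(ℚ_∞)^Γ` finite).  The restriction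
`Sel_str → Sel₀(ℚ_∞)^Γ = endInvariants (conj_γ − 1)` (§1; conjugates of level-`0` classes coincide) has kernel inside
`ker(H¹(ℚ_0, W[p^∞]) → H¹(ℚ_∞, W[p^∞]))`, whose order is `#W(ℚ̄)[p^∞]^{Γ_{ℚ_0}}` (Greenberg L.3.1 / L.4.3,
`WeierstrassCurve.natCard_ker_layerToInfty_eq_natCard_fixedPoints`).
[cite: GreenbergLNM1716, §3 Lemma 3.1 (p. 86) and §4 Lemma 4.3 (p. 103)] [cite: Kato2004Asterisque, (14.9.3) (p. 240)] -/
theorem natCard_katoStrictSelmer_le_mul (hp2 : p ≠ 2) (hκ : κ.IsCyclotomic) (γ : absoluteGaloisGroup ℚ)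
    [Finite (FixedPoints.addSubgroup κ.kerSubgroup (W.geomPrimaryTorsion p))]
    (hfinS : Finite (IwasawaDual.endInvariants (W.conjFineSelmerInfty κ γ - 1))) :
    Nat.card (katoStrictSelmer W p {primePlace p}) ≤
      Nat.card {m : W.geomPrimaryTorsion p | ∀ σ ∈ κ.layerSubgroup 0, σ • m = m} *
        Nat.card (IwasawaDual.endInvariants (W.conjFineSelmerInfty κ γ - 1)) := by
  set r := resH1Hom (Literature.NumberTheory.EllipticCurves.subgroupIncl κ.kerSubgroup)
    (AddMonoidHom.id (W.geomPrimaryTorsion p)) (fun _ _ ↦ rfl) with hr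
  set r₀ := resH1Hom (Literature.NumberTheory.EllipticCurves.subgroupIncl (κ.layerSubgroup 0))
    (AddMonoidHom.id (W.geomPrimaryTorsion p)) (fun _ _ ↦ rfl) with hr₀
  have hmem : ∀ y : katoStrictSelmer W p {primePlace p}, r y ∈ W.fineSelmerInfty κ := fun y ↦
    resH1Hom_kerSubgroup_mem_fineSelmerInfty_of_mem_katoStrictSelmer W κ hp2 hκ y.2
  have hinv : ∀ y : katoStrictSelmer W p {primePlace p},
      (⟨r y, hmem y⟩ : W.fineSelmerInfty κ) ∈ IwasawaDual.endInvariants (W.conjFineSelmerInfty κ γ - 1) := by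
    intro y
    rw [IwasawaDual.mem_endInvariants_iff]
    apply Subtype.ext
    rw [WeierstrassCurve.coe_conjFineSelmerInfty_sub_one_apply, ZeroMemClass.coe_zero, sub_eq_zero]
    change W.conjH1 p κ.kerSubgroup γ (r y) = r y
    rw [hr, resH1Hom_kerSubgroup_eq_layerToInfty]
    exact conjH1_layerToInfty_zero W κ γ _
  let ψ : katoStrictSelmer W p {primePlace p} →+ IwasawaDual.endInvariants (W.conjFineSelmerInfty κ γ - 1) :=
    { toFun := fun y ↦ ⟨⟨r y, hmem y⟩, hinv y⟩
      map_zero' := Subtype.ext (Subtype.ext (by simp))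
      map_add' := fun y y' ↦ Subtype.ext (Subtype.ext (by simp)) }
  -- `#Sel_str = #ker ψ · #range ψ`
  have hcard : Nat.card (katoStrictSelmer W p {primePlace p}) = Nat.card ψ.ker * Nat.card ψ.range := by
    rw [← AddSubgroup.index_ker ψ, AddSubgroup.card_mul_index]
  -- `ker ψ ↪ ker (layerToInfty κ 0)` through the bijection `H¹(Γ_ℚ, ·) ≃ H¹(κ⁻¹(ℤ_p), ·)`
  have hkermem : ∀ y : ψ.ker, r₀ (y : katoStrictSelmer W p {primePlace p}) ∈ (W.layerToInfty κ 0).ker := by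
    intro y
    have hy : ψ y = 0 := (AddMonoidHom.mem_ker).mp y.2
    have h1 : r (y : katoStrictSelmer W p {primePlace p}) = 0 :=
      congrArg (fun s : IwasawaDual.endInvariants (W.conjFineSelmerInfty κ γ - 1) ↦
        ((s : W.fineSelmerInfty κ) : W.subgroupH1 p κ.kerSubgroup)) hy
    rw [AddMonoidHom.mem_ker, ← resH1Hom_kerSubgroup_eq_layerToInfty]
    exact h1
  let j : ψ.ker → (W.layerToInfty κ 0).ker := fun y ↦ ⟨r₀ (y : katoStrictSelmer W p {primePlace p}), hkermem y⟩
  have hj : Function.Injective j := by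
    intro a b hab
    have h := congrArg (fun z : (W.layerToInfty κ 0).ker ↦ (z : W.subgroupH1 p (κ.layerSubgroup 0))) hab
    have h' : ((a : katoStrictSelmer W p {primePlace p}) : W.galH1Primary p) =
        ((b : katoStrictSelmer W p {primePlace p}) : W.galH1Primary p) :=
      (bijective_resH1Hom_layerSubgroup_zero W κ).1 h
    exact Subtype.ext (Subtype.ext h')
  -- the kernel of `layerToInfty κ 0` has order `#W(ℚ̄)[p^∞]^{Γ_{ℚ_0}}`, finite
  have hker : Nat.card (W.layerToInfty κ 0).ker = Nat.card {m : W.geomPrimaryTorsion p | ∀ σ ∈ κ.layerSubgroup 0, σ • m = m} :=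
    W.natCard_ker_layerToInfty_eq_natCard_fixedPoints κ 0
  haveI : Finite {m : W.geomPrimaryTorsion p | ∀ σ ∈ κ.layerSubgroup 0, σ • m = m} := by
    refine Finite.of_injective (fun m ↦ (⟨(m : W.geomPrimaryTorsion p), ?_⟩ :
      FixedPoints.addSubgroup κ.kerSubgroup (W.geomPrimaryTorsion p))) fun a b hab ↦ ?_
    · rw [FixedPoints.mem_addSubgroup]
      rintro ⟨τ, hτ⟩
      rw [Subgroup.mk_smul]
      exact m.2 τ (κ.kerSubgroup_le_layerSubgroup 0 hτ)
    · apply Subtype.ext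
      simpa using congrArg (fun z : FixedPoints.addSubgroup κ.kerSubgroup (W.geomPrimaryTorsion p) ↦
        (z : W.geomPrimaryTorsion p)) hab
  haveI : Nonempty {m : W.geomPrimaryTorsion p | ∀ σ ∈ κ.layerSubgroup 0, σ • m = m} :=
    ⟨⟨0, fun σ _ ↦ smul_zero σ⟩⟩
  have hker0 : Nat.card (W.layerToInfty κ 0).ker ≠ 0 := by rw [hker]; exact Nat.card_pos.ne'
  haveI : Finite (W.layerToInfty κ 0).ker := Nat.finite_of_card_ne_zero hker0
  haveI := hfinS
  have h1 : Nat.card ψ.ker ≤ Nat.card {m : W.geomPrimaryTorsion p | ∀ σ ∈ κ.layerSubgroup 0, σ • m = m} :=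
    hker ▸ Nat.card_le_card_of_injective j hj
  have h2 : Nat.card ψ.range ≤ Nat.card (IwasawaDual.endInvariants (W.conjFineSelmerInfty κ γ - 1)) :=
    Nat.card_le_card_of_injective _ Subtype.val_injective
  rw [hcard]
  exact Nat.mul_le_mul h1 h2

end Control

end Summit.BirchSwinnertonDyer.BirchSwinnertonDyer.Theorems.ReducibleShaBoundWild

end
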